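import Summits.NavierStokesRegularity.NavierStokesRegularity.Theorems.FilamentSkeletonRssCoreLinearInvertibilityClassClosureToolsB
import Summits.NavierStokesRegularity.NavierStokesRegularity.Theorems.FilamentSkeletonRssCoreLinearInvertibilityClassClosureCalc
import Summits.AnomalousDissipation.AnomalousDissipation.Theorems.MarginalStabilityChainStretchedVortexRowsStubCoreInverseIntegrabilityTools

/-!
# Tools for stub `stub_classClosure` (crux `CoreLinearInvertibility`, stmt-NavierStokesRegularity-17973,
# route `FilamentSkeletonRss`, line `Sketch`) — part D: the cut-off commutator tends to zero in `X_λ`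

For `w` in the crux class (`C²`, `w, T w, ∇w ∈ X_λ`, Biot–Savart integrable) and the radial
cut-offs `χ_k = cutoff (k+1)`, the Leibniz rule of part 2 gives
`T(χ_k w) − T w = A_k − R ⟪K∗((χ_k − 1)w), ∇G⟫` with the LOCAL commutator
`A_k = (χ_k − 1)(T w + R⟪K∗w, ∇G⟫) + w (Δχ_k + b_λ·∇χ_k − R Dχ_k[v^G]) + 2 Σᵢ ∂ᵢχ_k ∂ᵢw`.
Here `|A_k| ≤ |T w + R⟪K∗w,∇G⟫| + C(|w| + ‖Dw‖)` uniformly in `k` (cut-off derivative bounds of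
part 2, `‖v^G(x)‖ ≤ 1 + |x|`) and `A_k(x) = 0` eventually at every `x`, so `A_k → 0` in `X_λ` by
dominated convergence; and `⟪K∗((χ_k − 1)w), ∇G⟫ → 0` in `X_λ` by the Young-type bound of part B,
since `(χ_k − 1) w → 0` in `L¹ ∩ L²`.

References: folklore (the standard truncation argument for the maximal domain of `L_λ − RΛ`,
cf. Th. Gallay, Y. Maekawa, arXiv:1610.08384, §4.1).
-/

set_option linter.dupNamespace false

noncomputable section

namespace Summit.NavierStokesRegularity.NavierStokesRegularity.Theorems

open Set Function Filter MeasureTheory Topology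
open Literature.Analysis Literature.Analysis.FluidPDE
open Summit.AnomalousDissipation.AnomalousDissipation.Theorems.MarginalStabilityChainStretchedVortexRows
open scoped InnerProductSpace Laplacian ContDiff

section Commutator

variable {lam R : ℝ} {T : ℝ → ℝ → (EuclideanSpace ℝ (Fin 2) → ℝ) → EuclideanSpace ℝ (Fin 2) → ℝ}
  (hT : ∀ (lam R : ℝ) (w : EuclideanSpace ℝ (Fin 2) → ℝ) (x : EuclideanSpace ℝ (Fin 2)),
    T lam R w x = strainedVorticityOperator lam w x -
      R * (⟪gaussVortexVelocity x, gradient w x⟫_ℝ + ⟪biotSavart2D w x, gradient gaussVortexProfile x⟫_ℝ))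

include hT in
/-- **The cut-off commutator identity**: for `θ = cutoff r` and `w` `C²` with absolutely convergent
Biot–Savart integrals,
`T(θw) − Tw = (θ − 1)(Tw + R⟪K∗w, ∇G⟫) + w(L_λθ − θ − R Dθ[v^G]) + 2Σᵢ∂ᵢθ∂ᵢw − R⟪K∗((θ−1)w), ∇G⟫`.
[folklore] -/
theorem coreOp_cutoff_mul_sub {w : EuclideanSpace ℝ (Fin 2) → ℝ} (hw : ContDiff ℝ 2 w)
    (hwK : ∀ x, Integrable (fun y => w y • biotSavartKernel2D (x - y))) (r : ℝ)
    (x : EuclideanSpace ℝ (Fin 2)) :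
    T lam R (fun y => cutoff r y * w y) x - T lam R w x =
      (cutoff r x - 1) * (T lam R w x + R * ⟪biotSavart2D w x, gradient gaussVortexProfile x⟫_ℝ) +
        w x * (strainedVorticityOperator lam (cutoff r) x - cutoff r x -
          R * fderiv ℝ (cutoff r) x (gaussVortexVelocity x)) +
        2 * ∑ i, fderiv ℝ (cutoff r) x (EuclideanSpace.basisFun (Fin 2) ℝ i) *
          fderiv ℝ w x (EuclideanSpace.basisFun (Fin 2) ℝ i) -
        R * ⟪biotSavart2D (fun y => (cutoff r y - 1) * w y) x, gradient gaussVortexProfile x⟫_ℝ := by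
  have hθ : ContDiff ℝ 2 (cutoff (E := EuclideanSpace ℝ (Fin 2)) r) := contDiff_cutoff (n := 2) r
  have hθwK : ∀ x, Integrable (fun y => (cutoff r y * w y) • biotSavartKernel2D (x - y)) :=
    bsInt_mul_of_abs_le_one (contDiff_cutoff (n := 0) r).continuous (abs_cutoff_le_one r)
      hw.continuous hwK
  have hK : biotSavart2D (fun y => (cutoff r y - 1) * w y) x =
      biotSavart2D (fun y => cutoff r y * w y) x - biotSavart2D w x := by
    rw [← biotSavart2D_sub hθwK hwK]
    congr 1
    funext y
    ring
  rw [coreOp_mul hT hθ hw, hK, inner_sub_left, inner_sub_left, inner_smul_left]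
  simp only [RCLike.conj_to_real]
  ring

/-- **Uniform bound on the local commutator coefficients** along `χ_k = cutoff (k+1)`:
`|w (L_λχ_k − χ_k − R Dχ_k[v^G]) + 2Σᵢ∂ᵢχ_k ∂ᵢw| ≤ C (|w| + ‖Dw‖)` with `C` independent of `k`
(`|Δχ_k| ≤ C₂`, `|x|‖Dχ_k‖ ≤ 2C₁`, `‖Dχ_k‖ ≤ C₁`, `‖v^G(x)‖ ≤ 1 + |x|`). [folklore] -/
theorem exists_cutoff_commutator_bound (hlam : lam ∈ Set.Ico (0 : ℝ) 1) (R : ℝ) :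
    ∃ C : ℝ, 0 ≤ C ∧ ∀ (k : ℕ) (w : EuclideanSpace ℝ (Fin 2) → ℝ) (x : EuclideanSpace ℝ (Fin 2)),
      |w x * (strainedVorticityOperator lam (cutoff ((k : ℝ) + 1)) x - cutoff ((k : ℝ) + 1) x -
          R * fderiv ℝ (cutoff ((k : ℝ) + 1)) x (gaussVortexVelocity x)) +
        2 * ∑ i, fderiv ℝ (cutoff ((k : ℝ) + 1)) x (EuclideanSpace.basisFun (Fin 2) ℝ i) *
          fderiv ℝ w x (EuclideanSpace.basisFun (Fin 2) ℝ i)| ≤ C * (|w x| + ‖fderiv ℝ w x‖) := by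
  obtain ⟨C₁, hC₁0, hC₁⟩ := exists_norm_fderiv_cutoff_le (E := EuclideanSpace ℝ (Fin 2))
  obtain ⟨C₂, hC₂⟩ := exists_abs_laplacian_cutoff_le
  have hC₂0 : 0 ≤ C₂ := (abs_nonneg _).trans (hC₂ 1 le_rfl 0)
  refine ⟨C₂ + 4 * C₁ + 3 * |R| * C₁ + 4 * C₁, by positivity, fun k w x => ?_⟩
  set r : ℝ := (k : ℝ) + 1 with hr
  have hr0 : 0 < r := by positivity
  have hr1 : 1 ≤ r := by simp [hr]
  have hD : ‖fderiv ℝ (cutoff r) x‖ ≤ C₁ := by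
    refine (hC₁ r hr0 x).trans (div_le_self hC₁0 hr1)
  have hxD : ‖x‖ * ‖fderiv ℝ (cutoff r) x‖ ≤ 2 * C₁ := norm_mul_norm_fderiv_cutoff_le hC₁ hr0 x
  have hΔ : |Δ (cutoff (E := EuclideanSpace ℝ (Fin 2)) r) x| ≤ C₂ := hC₂ r hr1 x
  have hcoord : ∀ i : Fin 2, |x i * fderiv ℝ (cutoff r) x (EuclideanSpace.single i 1)| ≤ 2 * C₁ := fun i => by
    rw [abs_mul]
    calc |x i| * |fderiv ℝ (cutoff r) x (EuclideanSpace.single i 1)|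
        ≤ ‖x‖ * ‖fderiv ℝ (cutoff r) x‖ := by
          refine mul_le_mul (FourierNS.abs_apply_le_norm x i) ?_ (abs_nonneg _) (norm_nonneg _)
          rw [← Real.norm_eq_abs]
          refine (ContinuousLinearMap.le_opNorm _ _).trans ?_
          simp
      _ ≤ 2 * C₁ := hxD
  have hvG : |fderiv ℝ (cutoff r) x (gaussVortexVelocity x)| ≤ 3 * C₁ := by
    rw [← Real.norm_eq_abs]
    refine (ContinuousLinearMap.le_opNorm _ _).trans ?_
    have hv : ‖gaussVortexVelocity x‖ ≤ 1 + ‖x‖ := by simpa using norm_gaussVortexVelocity_le x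
    calc ‖fderiv ℝ (cutoff r) x‖ * ‖gaussVortexVelocity x‖ ≤ ‖fderiv ℝ (cutoff r) x‖ * (1 + ‖x‖) :=
          mul_le_mul_of_nonneg_left hv (norm_nonneg _)
      _ = ‖fderiv ℝ (cutoff r) x‖ + ‖x‖ * ‖fderiv ℝ (cutoff r) x‖ := by ring
      _ ≤ C₁ + 2 * C₁ := add_le_add hD hxD
      _ = 3 * C₁ := by ring
  have hsum : |∑ i, fderiv ℝ (cutoff r) x (EuclideanSpace.basisFun (Fin 2) ℝ i) *
      fderiv ℝ w x (EuclideanSpace.basisFun (Fin 2) ℝ i)| ≤ 2 * (C₁ * ‖fderiv ℝ w x‖) := by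
    have hi : ∀ i : Fin 2, |fderiv ℝ (cutoff r) x (EuclideanSpace.basisFun (Fin 2) ℝ i) *
        fderiv ℝ w x (EuclideanSpace.basisFun (Fin 2) ℝ i)| ≤ C₁ * ‖fderiv ℝ w x‖ := fun i => by
      rw [abs_mul, EuclideanSpace.basisFun_apply]
      have h1 : |fderiv ℝ (cutoff r) x (EuclideanSpace.single i 1)| ≤ C₁ := by
        rw [← Real.norm_eq_abs]
        refine (ContinuousLinearMap.le_opNorm _ _).trans ?_
        simpa using hD
      have h2 : |fderiv ℝ w x (EuclideanSpace.single i 1)| ≤ ‖fderiv ℝ w x‖ := by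
        rw [← Real.norm_eq_abs]
        refine (ContinuousLinearMap.le_opNorm _ _).trans ?_
        simp
      exact mul_le_mul h1 h2 (abs_nonneg _) hC₁0
    calc |∑ i, fderiv ℝ (cutoff r) x (EuclideanSpace.basisFun (Fin 2) ℝ i) *
          fderiv ℝ w x (EuclideanSpace.basisFun (Fin 2) ℝ i)|
        ≤ ∑ i, |fderiv ℝ (cutoff r) x (EuclideanSpace.basisFun (Fin 2) ℝ i) *
          fderiv ℝ w x (EuclideanSpace.basisFun (Fin 2) ℝ i)| := Finset.abs_sum_le_sum_abs _ _
      _ ≤ ∑ _i : Fin 2, C₁ * ‖fderiv ℝ w x‖ := Finset.sum_le_sum fun i _ => hi i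
      _ = 2 * (C₁ * ‖fderiv ℝ w x‖) := by simp
  -- the coefficient `c = Δχ + a₀x₀∂₀χ + a₁x₁∂₁χ − R Dχ[v^G]`
  have hc : |strainedVorticityOperator lam (cutoff r) x - cutoff r x -
      R * fderiv ℝ (cutoff r) x (gaussVortexVelocity x)| ≤ C₂ + 4 * C₁ + 3 * |R| * C₁ := by
    have ha0 : |(1 + lam) / 2| ≤ 1 := by rw [abs_of_nonneg (by linarith [hlam.1])]; linarith [hlam.2]
    have ha1 : |(1 - lam) / 2| ≤ 1 := by rw [abs_of_nonneg (by linarith [hlam.2])]; linarith [hlam.1]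
    have e : strainedVorticityOperator lam (cutoff r) x - cutoff r x -
        R * fderiv ℝ (cutoff r) x (gaussVortexVelocity x) =
        Δ (cutoff (E := EuclideanSpace ℝ (Fin 2)) r) x +
          (1 + lam) / 2 * (x 0 * fderiv ℝ (cutoff r) x (EuclideanSpace.single 0 1)) +
          (1 - lam) / 2 * (x 1 * fderiv ℝ (cutoff r) x (EuclideanSpace.single 1 1)) -
          R * fderiv ℝ (cutoff r) x (gaussVortexVelocity x) := by
      simp only [strainedVorticityOperator]
      ring
    have t1 : |(1 + lam) / 2 * (x 0 * fderiv ℝ (cutoff r) x (EuclideanSpace.single 0 1))| ≤ 2 * C₁ := by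
      rw [abs_mul]
      calc |(1 + lam) / 2| * |x 0 * fderiv ℝ (cutoff r) x (EuclideanSpace.single 0 1)| ≤ 1 * (2 * C₁) :=
            mul_le_mul ha0 (hcoord 0) (abs_nonneg _) zero_le_one
        _ = 2 * C₁ := one_mul _
    have t2 : |(1 - lam) / 2 * (x 1 * fderiv ℝ (cutoff r) x (EuclideanSpace.single 1 1))| ≤ 2 * C₁ := by
      rw [abs_mul]
      calc |(1 - lam) / 2| * |x 1 * fderiv ℝ (cutoff r) x (EuclideanSpace.single 1 1)| ≤ 1 * (2 * C₁) :=
            mul_le_mul ha1 (hcoord 1) (abs_nonneg _) zero_le_one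
        _ = 2 * C₁ := one_mul _
    have t3 : |R * fderiv ℝ (cutoff r) x (gaussVortexVelocity x)| ≤ |R| * (3 * C₁) := by
      rw [abs_mul]
      exact mul_le_mul_of_nonneg_left hvG (abs_nonneg R)
    rw [e]
    have s1 := abs_sub (Δ (cutoff (E := EuclideanSpace ℝ (Fin 2)) r) x +
      (1 + lam) / 2 * (x 0 * fderiv ℝ (cutoff r) x (EuclideanSpace.single 0 1)) +
      (1 - lam) / 2 * (x 1 * fderiv ℝ (cutoff r) x (EuclideanSpace.single 1 1)))
      (R * fderiv ℝ (cutoff r) x (gaussVortexVelocity x))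
    have s2 := abs_add_le (Δ (cutoff (E := EuclideanSpace ℝ (Fin 2)) r) x +
      (1 + lam) / 2 * (x 0 * fderiv ℝ (cutoff r) x (EuclideanSpace.single 0 1)))
      ((1 - lam) / 2 * (x 1 * fderiv ℝ (cutoff r) x (EuclideanSpace.single 1 1)))
    have s3 := abs_add_le (Δ (cutoff (E := EuclideanSpace ℝ (Fin 2)) r) x)
      ((1 + lam) / 2 * (x 0 * fderiv ℝ (cutoff r) x (EuclideanSpace.single 0 1)))
    linarith
  -- assemble
  calc |w x * (strainedVorticityOperator lam (cutoff r) x - cutoff r x -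
          R * fderiv ℝ (cutoff r) x (gaussVortexVelocity x)) +
        2 * ∑ i, fderiv ℝ (cutoff r) x (EuclideanSpace.basisFun (Fin 2) ℝ i) *
          fderiv ℝ w x (EuclideanSpace.basisFun (Fin 2) ℝ i)|
      ≤ |w x| * |strainedVorticityOperator lam (cutoff r) x - cutoff r x -
          R * fderiv ℝ (cutoff r) x (gaussVortexVelocity x)| +
        2 * |∑ i, fderiv ℝ (cutoff r) x (EuclideanSpace.basisFun (Fin 2) ℝ i) *
          fderiv ℝ w x (EuclideanSpace.basisFun (Fin 2) ℝ i)| := by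
        refine (abs_add_le _ _).trans ?_
        rw [abs_mul, abs_mul, abs_two]
    _ ≤ |w x| * (C₂ + 4 * C₁ + 3 * |R| * C₁) + 2 * (2 * (C₁ * ‖fderiv ℝ w x‖)) := by
        gcongr
    _ ≤ (C₂ + 4 * C₁ + 3 * |R| * C₁ + 4 * C₁) * (|w x| + ‖fderiv ℝ w x‖) := by
        nlinarith [abs_nonneg (w x), norm_nonneg (fderiv ℝ w x), abs_nonneg R,
          mul_nonneg (abs_nonneg R) hC₁0]

/-- **At every fixed `x` the local commutator coefficients vanish eventually** along
`χ_k = cutoff (k+1)` (`χ_k = 1` near `x` for `k + 1 > ‖x‖`). [folklore] -/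
theorem eventually_cutoff_commutator_eq_zero (x : EuclideanSpace ℝ (Fin 2)) :
    ∀ᶠ k : ℕ in atTop, cutoff ((k : ℝ) + 1) x - 1 = 0 ∧
      fderiv ℝ (cutoff (E := EuclideanSpace ℝ (Fin 2)) ((k : ℝ) + 1)) x = 0 ∧
      strainedVorticityOperator lam (cutoff ((k : ℝ) + 1)) x - cutoff ((k : ℝ) + 1) x = 0 := by
  filter_upwards [eventually_cutoff_natCast_eventuallyEq_one x] with k hk
  have h1 : cutoff ((k : ℝ) + 1) x = 1 := hk.eq_of_nhds
  have h2 : fderiv ℝ (cutoff (E := EuclideanSpace ℝ (Fin 2)) ((k : ℝ) + 1)) x = 0 := by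
    rw [hk.fderiv_eq]; simp
  have h3 : Δ (cutoff (E := EuclideanSpace ℝ (Fin 2)) ((k : ℝ) + 1)) x = 0 := by
    rw [(InnerProductSpace.laplacian_congr_nhds hk).eq_of_nhds]
    simp [InnerProductSpace.laplacian_const]
  refine ⟨by rw [h1]; ring, h2, ?_⟩
  simp only [strainedVorticityOperator, h3, h2, h1]
  simp

include hT in
/-- **The local commutator tends to zero in `X_λ`** (dominated convergence: uniform bound
`|A_k| ≤ |Tw + R⟪K∗w,∇G⟫| + C(|w| + ‖Dw‖) ∈ X_λ`, and `A_k(x) = 0` eventually). [folklore] -/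
theorem xconv_cutoff_commutator_local (hlam : lam ∈ Set.Ico (0 : ℝ) 1)
    {w : EuclideanSpace ℝ (Fin 2) → ℝ} (hw : ContDiff ℝ 2 w)
    (hwK : ∀ x, Integrable (fun y => w y • biotSavartKernel2D (x - y)))
    (hwX : Integrable (fun x => (gaussWeightLam lam x)⁻¹ * w x ^ 2))
    (hTX : Integrable (fun x => (gaussWeightLam lam x)⁻¹ * T lam R w x ^ 2))
    (hgrad : Integrable (fun x => (gaussWeightLam lam x)⁻¹ * ‖gradient w x‖ ^ 2)) :
    (∀ k : ℕ, AEStronglyMeasurable (fun x =>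
      (cutoff ((k : ℝ) + 1) x - 1) * (T lam R w x + R * ⟪biotSavart2D w x, gradient gaussVortexProfile x⟫_ℝ) +
        (w x * (strainedVorticityOperator lam (cutoff ((k : ℝ) + 1)) x - cutoff ((k : ℝ) + 1) x -
          R * fderiv ℝ (cutoff ((k : ℝ) + 1)) x (gaussVortexVelocity x)) +
        2 * ∑ i, fderiv ℝ (cutoff ((k : ℝ) + 1)) x (EuclideanSpace.basisFun (Fin 2) ℝ i) *
          fderiv ℝ w x (EuclideanSpace.basisFun (Fin 2) ℝ i))) volume) ∧
    (∀ k : ℕ, Integrable (fun x => (gaussWeightLam lam x)⁻¹ *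
      ((cutoff ((k : ℝ) + 1) x - 1) * (T lam R w x + R * ⟪biotSavart2D w x, gradient gaussVortexProfile x⟫_ℝ) +
        (w x * (strainedVorticityOperator lam (cutoff ((k : ℝ) + 1)) x - cutoff ((k : ℝ) + 1) x -
          R * fderiv ℝ (cutoff ((k : ℝ) + 1)) x (gaussVortexVelocity x)) +
        2 * ∑ i, fderiv ℝ (cutoff ((k : ℝ) + 1)) x (EuclideanSpace.basisFun (Fin 2) ℝ i) *
          fderiv ℝ w x (EuclideanSpace.basisFun (Fin 2) ℝ i))) ^ 2)) ∧
    Tendsto (fun k : ℕ => ∫ x, (gaussWeightLam lam x)⁻¹ *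
      ((cutoff ((k : ℝ) + 1) x - 1) * (T lam R w x + R * ⟪biotSavart2D w x, gradient gaussVortexProfile x⟫_ℝ) +
        (w x * (strainedVorticityOperator lam (cutoff ((k : ℝ) + 1)) x - cutoff ((k : ℝ) + 1) x -
          R * fderiv ℝ (cutoff ((k : ℝ) + 1)) x (gaussVortexVelocity x)) +
        2 * ∑ i, fderiv ℝ (cutoff ((k : ℝ) + 1)) x (EuclideanSpace.basisFun (Fin 2) ℝ i) *
          fderiv ℝ w x (EuclideanSpace.basisFun (Fin 2) ℝ i))) ^ 2) atTop (𝓝 0) := by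
  obtain ⟨C, hC0, hC⟩ := exists_cutoff_commutator_bound hlam R
  obtain ⟨CY, -, hY⟩ := exists_inv_gaussWeightLam_mul_inner_biotSavart2D_sq_le hlam
  obtain ⟨hwi, hw2⟩ := integrable_and_sq_of_memX hlam.2 hw.continuous.aestronglyMeasurable hwX
  obtain ⟨hNi, -⟩ := hY w hw.continuous hwi hw2
  have hTm := aestronglyMeasurable_coreOp hT hw (lam := lam) (R := R)
  have hNm : AEStronglyMeasurable (fun x => ⟪biotSavart2D w x, gradient gaussVortexProfile x⟫_ℝ) volume :=
    (stronglyMeasurable_biotSavart2D hw.continuous.measurable).aestronglyMeasurable.inner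
      (continuous_gradient_of_contDiff (contDiff_gaussVortexProfile (n := 1))).aestronglyMeasurable
  have hDc : Continuous (fderiv ℝ w) := hw.continuous_fderiv two_ne_zero
  have hgrad' : Integrable (fun x => (gaussWeightLam lam x)⁻¹ * ‖fderiv ℝ w x‖ ^ 2) := by
    simpa [norm_gradient_eq_norm_fderiv] using hgrad
  -- the dominating function
  set P : EuclideanSpace ℝ (Fin 2) → ℝ := fun x =>
    |T lam R w x + R * ⟪biotSavart2D w x, gradient gaussVortexProfile x⟫_ℝ| + C * (|w x| + ‖fderiv ℝ w x‖)
    with hP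
  have hg : ∀ x, 0 ≤ (gaussWeightLam lam x)⁻¹ := fun x => inv_nonneg.2 (gaussWeightLam_pos hlam.2 x).le
  have hPm : AEStronglyMeasurable P volume :=
    (continuous_abs.comp_aestronglyMeasurable (hTm.add (hNm.const_mul R))).add
      (((continuous_abs.comp hw.continuous).add hDc.norm).aestronglyMeasurable.const_mul C)
  have hPi : Integrable (fun x => (gaussWeightLam lam x)⁻¹ * P x ^ 2) := by
    refine Integrable.mono'
      ((((hTX.const_mul 2).add ((hNi.const_mul (R ^ 2)).const_mul 2)).add
        ((hwX.const_mul (C ^ 2)).add (hgrad'.const_mul (C ^ 2)))).const_mul 3)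
      ((continuous_inv_gaussWeightLam hlam.2).aestronglyMeasurable.mul (hPm.pow 2))
      (Eventually.of_forall fun x => ?_)
    rw [Real.norm_of_nonneg (mul_nonneg (hg x) (sq_nonneg _))]
    simp only [hP, Pi.add_apply]
    have hsq : (|T lam R w x + R * ⟪biotSavart2D w x, gradient gaussVortexProfile x⟫_ℝ| +
        C * (|w x| + ‖fderiv ℝ w x‖)) ^ 2 ≤
        3 * (2 * T lam R w x ^ 2 + 2 * (R ^ 2 * ⟪biotSavart2D w x, gradient gaussVortexProfile x⟫_ℝ ^ 2) +
          (C ^ 2 * w x ^ 2 + C ^ 2 * ‖fderiv ℝ w x‖ ^ 2)) := by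
      have e1 : |T lam R w x + R * ⟪biotSavart2D w x, gradient gaussVortexProfile x⟫_ℝ| ^ 2 =
          (T lam R w x + R * ⟪biotSavart2D w x, gradient gaussVortexProfile x⟫_ℝ) ^ 2 := sq_abs _
      have e2 : |w x| ^ 2 = w x ^ 2 := sq_abs _
      nlinarith [sq_nonneg (|T lam R w x + R * ⟪biotSavart2D w x, gradient gaussVortexProfile x⟫_ℝ| - C * |w x|),
        sq_nonneg (|T lam R w x + R * ⟪biotSavart2D w x, gradient gaussVortexProfile x⟫_ℝ| - C * ‖fderiv ℝ w x‖),
        sq_nonneg (C * |w x| - C * ‖fderiv ℝ w x‖),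
        sq_nonneg (T lam R w x - R * ⟪biotSavart2D w x, gradient gaussVortexProfile x⟫_ℝ)]
    have := mul_le_mul_of_nonneg_left hsq (hg x)
    linarith
  refine xconv_of_dominated (X := fun φ : ℕ → EuclideanSpace ℝ (Fin 2) → ℝ =>
    (∀ k, AEStronglyMeasurable (φ k) volume) ∧
      (∀ k, Integrable (fun x => (gaussWeightLam lam x)⁻¹ * φ k x ^ 2)) ∧
        Tendsto (fun k => ∫ x, (gaussWeightLam lam x)⁻¹ * φ k x ^ 2) atTop (𝓝 0))
    (fun _ => Iff.rfl) hlam.2 (P := P) (fun k => ?_) hPi (fun k x => ?_) (fun x => ?_)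
  · -- measurability of `A_k`, through `A_k = T(χ_k w) − Tw + R⟪K∗((χ_k−1)w), ∇G⟫`
    have hχ : ContDiff ℝ 2 (cutoff (E := EuclideanSpace ℝ (Fin 2)) ((k : ℝ) + 1)) := contDiff_cutoff (n := 2) _
    have hA : (fun x => (cutoff ((k : ℝ) + 1) x - 1) *
        (T lam R w x + R * ⟪biotSavart2D w x, gradient gaussVortexProfile x⟫_ℝ) +
        (w x * (strainedVorticityOperator lam (cutoff ((k : ℝ) + 1)) x - cutoff ((k : ℝ) + 1) x -
          R * fderiv ℝ (cutoff ((k : ℝ) + 1)) x (gaussVortexVelocity x)) +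
        2 * ∑ i, fderiv ℝ (cutoff ((k : ℝ) + 1)) x (EuclideanSpace.basisFun (Fin 2) ℝ i) *
          fderiv ℝ w x (EuclideanSpace.basisFun (Fin 2) ℝ i))) =
        fun x => (T lam R (fun y => cutoff ((k : ℝ) + 1) y * w y) x - T lam R w x) +
          R * ⟪biotSavart2D (fun y => (cutoff ((k : ℝ) + 1) y - 1) * w y) x,
            gradient gaussVortexProfile x⟫_ℝ := by
      funext x
      rw [coreOp_cutoff_mul_sub hT hw hwK]
      ring
    rw [hA]
    have hv : Continuous fun y => (cutoff ((k : ℝ) + 1) y - 1) * w y :=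
      ((contDiff_cutoff (n := 0) _).continuous.sub continuous_const).mul hw.continuous
    exact ((aestronglyMeasurable_coreOp hT (hχ.mul hw) (lam := lam) (R := R)).sub hTm).add
      (((stronglyMeasurable_biotSavart2D hv.measurable).aestronglyMeasurable.inner
        (continuous_gradient_of_contDiff (contDiff_gaussVortexProfile (n := 1))).aestronglyMeasurable).const_mul R)
  · -- the uniform bound
    have h1 := hC k w x
    have h2 : |(cutoff ((k : ℝ) + 1) x - 1) *
        (T lam R w x + R * ⟪biotSavart2D w x, gradient gaussVortexProfile x⟫_ℝ)| ≤
        |T lam R w x + R * ⟪biotSavart2D w x, gradient gaussVortexProfile x⟫_ℝ| := by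
      rw [abs_mul]
      calc |cutoff ((k : ℝ) + 1) x - 1| * |T lam R w x + R * ⟪biotSavart2D w x, gradient gaussVortexProfile x⟫_ℝ|
          ≤ 1 * |T lam R w x + R * ⟪biotSavart2D w x, gradient gaussVortexProfile x⟫_ℝ| :=
            mul_le_mul_of_nonneg_right (abs_cutoff_sub_one_le _ x) (abs_nonneg _)
        _ = _ := one_mul _
    simp only [hP]
    exact (abs_add_le _ _).trans (add_le_add h2 h1)
  · -- pointwise: eventually zero
    refine tendsto_const_nhds.congr' ?_
    filter_upwards [eventually_cutoff_commutator_eq_zero x (lam := lam)] with k hk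
    obtain ⟨h1, h2, h3⟩ := hk
    rw [h3, h2, h1]
    simp

/-- **The nonlocal commutator tends to zero in `X_λ`**: with `v_k = (χ_k − 1) w → 0` in
`L¹ ∩ L²` (dominated convergence), `∫ G_λ⁻¹ (R⟪K∗v_k, ∇G⟫)² ≤ R² C (∫ v_k² + ‖v_k‖₁²) → 0` by the
Young-type bound of part B. [folklore] -/
theorem xconv_cutoff_commutator_nonlocal (hlam : lam ∈ Set.Ico (0 : ℝ) 1) (R : ℝ)
    {w : EuclideanSpace ℝ (Fin 2) → ℝ} (hw : Continuous w)
    (hwX : Integrable (fun x => (gaussWeightLam lam x)⁻¹ * w x ^ 2)) :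
    (∀ k : ℕ, AEStronglyMeasurable (fun x => R * ⟪biotSavart2D (fun y => (cutoff ((k : ℝ) + 1) y - 1) * w y) x,
      gradient gaussVortexProfile x⟫_ℝ) volume) ∧
    (∀ k : ℕ, Integrable (fun x => (gaussWeightLam lam x)⁻¹ *
      (R * ⟪biotSavart2D (fun y => (cutoff ((k : ℝ) + 1) y - 1) * w y) x, gradient gaussVortexProfile x⟫_ℝ) ^ 2)) ∧
    Tendsto (fun k : ℕ => ∫ x, (gaussWeightLam lam x)⁻¹ *
      (R * ⟪biotSavart2D (fun y => (cutoff ((k : ℝ) + 1) y - 1) * w y) x, gradient gaussVortexProfile x⟫_ℝ) ^ 2)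
      atTop (𝓝 0) := by
  obtain ⟨CY, hCY0, hY⟩ := exists_inv_gaussWeightLam_mul_inner_biotSavart2D_sq_le hlam
  obtain ⟨hwi, hw2⟩ := integrable_and_sq_of_memX hlam.2 hw.aestronglyMeasurable hwX
  obtain ⟨v, hv⟩ : ∃ v : ℕ → EuclideanSpace ℝ (Fin 2) → ℝ,
      ∀ k y, v k y = (cutoff ((k : ℝ) + 1) y - 1) * w y := ⟨_, fun _ _ => rfl⟩
  simp only [← hv]
  have hvc : ∀ k, Continuous (v k) := fun k => by
    rw [show v k = fun y => (cutoff ((k : ℝ) + 1) y - 1) * w y from funext (hv k)]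
    exact ((contDiff_cutoff (n := 0) _).continuous.sub continuous_const).mul hw
  have hvle : ∀ k y, |v k y| ≤ |w y| := fun k y => by
    rw [hv, abs_mul]
    calc |cutoff ((k : ℝ) + 1) y - 1| * |w y| ≤ 1 * |w y| :=
          mul_le_mul_of_nonneg_right (abs_cutoff_sub_one_le _ y) (abs_nonneg _)
      _ = |w y| := one_mul _
  have hvi : ∀ k, Integrable (v k) := fun k =>
    hwi.mono (hvc k).aestronglyMeasurable (Eventually.of_forall fun y => by
      simpa only [Real.norm_eq_abs] using hvle k y)
  have hv2le : ∀ k y, v k y ^ 2 ≤ w y ^ 2 := fun k y => by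
    rw [← sq_abs (v k y), ← sq_abs (w y)]
    exact pow_le_pow_left₀ (abs_nonneg _) (hvle k y) 2
  have hv2 : ∀ k, Integrable (fun y => v k y ^ 2) := fun k =>
    hw2.mono ((hvc k).pow 2).aestronglyMeasurable (Eventually.of_forall fun y => by
      rw [Real.norm_of_nonneg (sq_nonneg _), Real.norm_of_nonneg (sq_nonneg _)]
      exact hv2le k y)
  have hvlim : ∀ y, Tendsto (fun k => v k y) atTop (𝓝 0) := fun y => by
    have h := ((tendsto_cutoff_natCast_add_one y).sub_const 1).mul_const (w y)
    rw [show (fun k => v k y) = fun k : ℕ => (cutoff ((k : ℝ) + 1) y - 1) * w y from funext fun k => hv k y]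
    simpa using h
  -- `∫ v_k² → 0` and `∫ |v_k| → 0`
  have hI2 : Tendsto (fun k => ∫ y, v k y ^ 2) atTop (𝓝 0) := by
    have h := tendsto_integral_of_dominated_convergence (F := fun k y => v k y ^ 2) (fun y => w y ^ 2)
      (fun k => ((hvc k).pow 2).aestronglyMeasurable) hw2
      (fun k => Eventually.of_forall fun y => by
        rw [Real.norm_of_nonneg (sq_nonneg _)]; exact hv2le k y)
      (Eventually.of_forall fun y => ((hvlim y).pow 2 : Tendsto (fun k => v k y ^ 2) atTop (𝓝 ((0:ℝ) ^ 2))))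
    simpa using h
  have hI1 : Tendsto (fun k => ∫ y, |v k y|) atTop (𝓝 0) := by
    have h := tendsto_integral_of_dominated_convergence (F := fun k y => |v k y|) (fun y => |w y|)
      (fun k => (continuous_abs.comp (hvc k)).aestronglyMeasurable) hwi.abs
      (fun k => Eventually.of_forall fun y => by
        rw [Real.norm_eq_abs, abs_abs]; exact hvle k y)
      (Eventually.of_forall fun y => ((hvlim y).abs : Tendsto (fun k => |v k y|) atTop (𝓝 |(0:ℝ)|)))
    simpa using h
  have hNm : ∀ k, AEStronglyMeasurable
      (fun x => ⟪biotSavart2D (v k) x, gradient gaussVortexProfile x⟫_ℝ) volume := fun k =>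
    (stronglyMeasurable_biotSavart2D (hvc k).measurable).aestronglyMeasurable.inner
      (continuous_gradient_of_contDiff (contDiff_gaussVortexProfile (n := 1))).aestronglyMeasurable
  have heq : ∀ k, (fun x => (gaussWeightLam lam x)⁻¹ *
      (R * ⟪biotSavart2D (v k) x, gradient gaussVortexProfile x⟫_ℝ) ^ 2) =
      fun x => R ^ 2 * ((gaussWeightLam lam x)⁻¹ * ⟪biotSavart2D (v k) x, gradient gaussVortexProfile x⟫_ℝ ^ 2) := by
    intro k; funext x; ring
  refine ⟨fun k => (hNm k).const_mul R, fun k => ?_, ?_⟩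
  · rw [heq k]
    exact (hY (v k) (hvc k) (hvi k) (hv2 k)).1.const_mul _
  · simp_rw [heq, integral_const_mul]
    have hup : ∀ k, R ^ 2 * ∫ x, (gaussWeightLam lam x)⁻¹ * ⟪biotSavart2D (v k) x, gradient gaussVortexProfile x⟫_ℝ ^ 2 ≤
        R ^ 2 * (CY * ((∫ y, v k y ^ 2) + (∫ y, |v k y|) ^ 2)) := fun k =>
      mul_le_mul_of_nonneg_left (hY (v k) (hvc k) (hvi k) (hv2 k)).2 (sq_nonneg R)
    refine squeeze_zero (fun k => mul_nonneg (sq_nonneg R) (integral_nonneg fun x =>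
      mul_nonneg (inv_nonneg.2 (gaussWeightLam_pos hlam.2 x).le) (sq_nonneg _))) hup ?_
    simpa using ((hI2.add (hI1.pow 2)).const_mul CY).const_mul (R ^ 2)

end Commutator

/-- **Registered tools stub `stub_classClosureToolsE`** (helpers for `stub_classClosure`, line
`Sketch` of crux `CoreLinearInvertibility`, stmt-NavierStokesRegularity-17973): at every fixed point
the local commutator coefficients of the cut-offs `χ_k = cutoff (k+1)` vanish eventually. [folklore] -/
theorem stub_classClosureToolsE :
    ∀ (lam : ℝ) (x : EuclideanSpace ℝ (Fin 2)), ∀ᶠ k : ℕ in atTop, cutoff ((k : ℝ) + 1) x - 1 = 0 ∧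
      fderiv ℝ (cutoff (E := EuclideanSpace ℝ (Fin 2)) ((k : ℝ) + 1)) x = 0 ∧
      strainedVorticityOperator lam (cutoff ((k : ℝ) + 1)) x - cutoff ((k : ℝ) + 1) x = 0 :=
  fun _ x => eventually_cutoff_commutator_eq_zero x

end Summit.NavierStokesRegularity.NavierStokesRegularity.Theorems
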